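import Summits.QuantumFields.YangMills.Theorems.Instrument.PlaquetteLinkGeometry
import Literature.Probability.LatticeModels.LatticeGreenGradient
import HarnessLib

/-!
# Instrument cell `ym-instrument`, crew (b): the two neighbours of a plaquette across its two PARALLEL links share no link; hence NO closed complex of `ℤ⁴` with five plaquettes
# (`closedCount 4 n = 0` for every `n ≤ 5` — the smallest closed complex is the 6-plaquette cube boundary; typed census zero for the KP rows at vanishing order `n₀ = 6`)

QUESTIONS.md: Q-B1 (typed KP windows: `KPCriterionSU2UnconditionalT2.kpCriterionSU2_of_t2` at `n₀ = 6` gives the radius `27/800`, sc-ref pre-check 2026-08-27T01:42:01Z); cell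
`run/shared/lean/pub/ym-instrument/`, HUMAN RULING D-0084 (2), director-ym R138.  HONEST FRAMING (page 1, binding).  WHAT IS CERTIFIED HERE AND AT WHICH `(G, D, L, β)`: PURE
COMBINATORICS of `ℤ⁴`: (§1) for a plaquette `p = (x; i, j)`, a plaquette `q ≠ p` through its link `(x, i)` and a plaquette `r ≠ p` through the PARALLEL link `(x + e_j, i)` have NO
common link (`disjoint_plaquetteEdges_of_parallel`: every link of `q` has upper `j`-level `≤ x_j`, every link of `r` has lower `j`-level `≥ x_j + 1`); (§2) ★ `closedCount 4 n = 0` for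
`n ≤ 5` (`closedCount_four_eq_zero_of_le_five`): in a closed complex the two parallel `i`-links of a member `p` each lie in a second plaquette `q ≠ p`, `r ≠ p`, `q ≠ r` (two shared
links force equality, `PlaquetteLinkGeometry.eq_of_mem_plaquetteEdges_of_ne`), and the pair `{q, r}` shares no link, so `4n = Σ_l deg l ≤ 2·Σ_l C(deg l, 2) ≤ 2·(C(n, 2) − 1)`, i.e.
`n ≥ 6`.  The census VALUE `closedCount 4 6 = 12` (cubes) is NOT typed.  NOT a statement about any gauge theory, NOT a radius, NOT summit-bearing.  Grade (T).
-/

noncomputable section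

open Finset
open Literature.MathematicalPhysics.QuantumLattice (ZdEdge ZdPlaquette plaquetteEdges)
open Literature.MathematicalPhysics.QuantumFieldTheory (mk_mem_plaquetteEdges_iff)
open Literature.MathematicalPhysics.QuantumFieldTheory.Balaban1983to89.StrongCouplingKPWindow (links IsLinkConnected IsClosedComplex rootLink closedCount)
open Literature.Probability.LatticeModels (Site add_single_apply_self add_single_apply_ne)
open Summit.QuantumFields.YangMills.Theorems.Instrument.ClosedComplexExploration (atLink)
open Summit.QuantumFields.YangMills.Theorems.Instrument.PlaquetteLinkGeometry (eq_of_mem_plaquetteEdges_of_ne sum_card_atLink_eq)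

namespace Summit.QuantumFields.YangMills.Theorems.Instrument.PlaquetteParallelLinks

variable {d : ℕ}

/-! ## §1 Levels of links in a fixed direction -/

/-- The upper `j`-level of a link `(y, m)`: `y_j`, plus one when the link points in direction `j`. [folklore] -/
def hiLevel (j : Fin d) (ℓ : ZdEdge d) : ℤ := ℓ.1 j + if ℓ.2 = j then 1 else 0

/-- `y_j ≤ hiLevel j (y, m)`. [folklore] -/
theorem fst_le_hiLevel (j : Fin d) (ℓ : ZdEdge d) : ℓ.1 j ≤ hiLevel j ℓ := by
  unfold hiLevel; split_ifs <;> omega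

/-- `(y + e_a)_j ≤ y_j + 1` and `y_j ≤ (y + e_a)_j`. [folklore] -/
theorem add_single_apply_bounds (y : Site d) (a j : Fin d) : y j ≤ (y + Pi.single a 1 : Site d) j ∧ (y + Pi.single a 1 : Site d) j ≤ y j + 1 := by
  by_cases h : a = j
  · subst h; rw [add_single_apply_self]; omega
  · rw [add_single_apply_ne y (Ne.symm h)]; omega

/-- Every link `ℓ` of a plaquette `q = (y; a, b)`: `y_j ≤ ℓ.1 j`, and `hiLevel j ℓ ≤ y_j` unless `q` is parallel to `j` (`a = j` or `b = j`), in which case `hiLevel j ℓ ≤ y_j + 1`.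
[folklore] -/
theorem levels_of_mem {q : ZdPlaquette d} {ℓ : ZdEdge d} (hℓ : ℓ ∈ plaquetteEdges q) (j : Fin d) :
    q.1 j ≤ ℓ.1 j ∧ hiLevel j ℓ ≤ q.1 j + 1 ∧ (q.2.1.1 ≠ j → q.2.1.2 ≠ j → hiLevel j ℓ ≤ q.1 j) := by
  obtain ⟨y, ⟨⟨a, b⟩, hab⟩⟩ := q
  dsimp only
  have hab' : a ≠ b := ne_of_lt hab
  simp only [plaquetteEdges, mem_insert, mem_singleton] at hℓ
  have hA := add_single_apply_bounds y a j
  have hB := add_single_apply_bounds y b j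
  rcases hℓ with rfl | rfl | rfl | rfl <;> simp only [hiLevel] <;> refine ⟨by omega, ?_, fun haj hbj => ?_⟩
  · split_ifs <;> omega
  · rw [if_neg haj]; omega
  · split_ifs with h
    · have := add_single_apply_ne y (i := a) (j := j) (fun h' => hab' (h'.symm.trans h.symm)); omega
    · omega
  · rw [if_neg hbj, add_single_apply_ne y (Ne.symm haj)]; omega
  · split_ifs with h
    · have := add_single_apply_ne y (i := b) (j := j) (fun h' => hab' (h.trans h')); omega
    · omega
  · rw [if_neg haj, add_single_apply_ne y (Ne.symm hbj)]; omega
  · split_ifs <;> omega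
  · rw [if_neg hbj]; omega

/-! ## §2 The two neighbours across parallel links share no link -/

/-- A plaquette `q ≠ p` through the link `(x, i)` of `p = (x; i, j)` lies weakly BELOW level `x_j` in direction `j`: every link of `q` has upper `j`-level `≤ x_j`. [folklore] -/
theorem hiLevel_le_of_mem_base {p q : ZdPlaquette d} (hqp : q ≠ p) (hq : ((p.1, p.2.1.1) : ZdEdge d) ∈ plaquetteEdges q) {ℓ : ZdEdge d} (hℓ : ℓ ∈ plaquetteEdges q) :
    hiLevel p.2.1.2 ℓ ≤ p.1 p.2.1.2 := by
  have hb := levels_of_mem hℓ p.2.1.2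
  obtain ⟨x, ⟨⟨i, j⟩, hij⟩⟩ := p
  obtain ⟨y, ⟨⟨a, b⟩, hab⟩⟩ := q
  dsimp only at hb hq hqp ⊢
  have hij' : (i : ℕ) < j := hij
  have hab' : (a : ℕ) < b := hab
  obtain ⟨-, hb1, hb0⟩ := hb
  rw [mk_mem_plaquetteEdges_iff] at hq
  dsimp only at hq
  rcases hq with ⟨rfl, rfl | rfl⟩ | ⟨rfl, rfl | rfl⟩
  · -- `a = i`, `x = y`: `b ≠ j` since `q ≠ p`, and `a = i ≠ j`
    have haj : a ≠ j := fun h => by subst h; omega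
    have hbj : b ≠ j := fun h => hqp (by subst h; rfl)
    exact hb0 haj hbj
  · -- `a = i`, `x = y + e_b`
    have haj : a ≠ j := fun h => by subst h; omega
    by_cases hbj : b = j
    · subst hbj; rw [add_single_apply_self]; exact hb1
    · rw [add_single_apply_ne y (Ne.symm hbj)]; exact hb0 haj hbj
  · -- `b = i`, `x = y + e_a`: `a < b = i < j`
    have haj : a ≠ j := fun h => by subst h; omega
    have hbj : b ≠ j := fun h => by subst h; omega
    rw [add_single_apply_ne y (Ne.symm haj)]; exact hb0 haj hbj
  · -- `b = i`, `x = y`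
    have haj : a ≠ j := fun h => by subst h; omega
    have hbj : b ≠ j := fun h => by subst h; omega
    exact hb0 haj hbj

/-- A plaquette `r ≠ p` through the PARALLEL link `(x + e_j, i)` of `p = (x; i, j)` lies weakly ABOVE level `x_j + 1`: every link of `r` has lower `j`-level `≥ x_j + 1`. [folklore] -/
theorem le_fst_of_mem_shift {p r : ZdPlaquette d} (hrp : r ≠ p) (hr : ((p.1 + Pi.single p.2.1.2 1, p.2.1.1) : ZdEdge d) ∈ plaquetteEdges r) {ℓ : ZdEdge d}
    (hℓ : ℓ ∈ plaquetteEdges r) : p.1 p.2.1.2 + 1 ≤ ℓ.1 p.2.1.2 := by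
  have hb := levels_of_mem hℓ p.2.1.2
  obtain ⟨x, ⟨⟨i, j⟩, hij⟩⟩ := p
  obtain ⟨y, ⟨⟨a, b⟩, hab⟩⟩ := r
  dsimp only at hb hr hrp ⊢
  have hij' : (i : ℕ) < j := hij
  have hab' : (a : ℕ) < b := hab
  obtain ⟨hb, -, -⟩ := hb
  rw [mk_mem_plaquetteEdges_iff] at hr
  dsimp only at hr
  -- from the membership, `x_j + 1 ≤ y_j`
  have key : x j + 1 ≤ y j := by
    rcases hr with ⟨rfl, h | h⟩ | ⟨rfl, h | h⟩
    · -- `a = i`, `x + e_j = y`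
      have := congrFun h j; rw [add_single_apply_self] at this; omega
    · -- `a = i`, `x + e_j = y + e_b`: `b = j` would force `y = x` and `r = p`
      have hbj : b ≠ j := by
        rintro rfl
        exact hrp (by rw [add_right_cancel h.symm])
      have := congrFun h j; rw [add_single_apply_self, add_single_apply_ne y (Ne.symm hbj)] at this; omega
    · -- `b = i`, `x + e_j = y + e_a`: `a < b = i < j`, so `a ≠ j`
      have haj : a ≠ j := fun h' => by subst h'; omega
      have := congrFun h j; rw [add_single_apply_self, add_single_apply_ne y (Ne.symm haj)] at this; omega
    · -- `b = i`, `x + e_j = y`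
      have := congrFun h j; rw [add_single_apply_self] at this; omega
  omega

/-- ★ **The two neighbours of a plaquette across its two parallel links share no link**: if `q ≠ p` contains the link `(x, i)` of `p = (x; i, j)` and `r ≠ p` contains the parallel
link `(x + e_j, i)`, then `plaquetteEdges q` and `plaquetteEdges r` are disjoint. [folklore] -/
theorem disjoint_plaquetteEdges_of_parallel {p q r : ZdPlaquette d} (hqp : q ≠ p) (hrp : r ≠ p) (hq : ((p.1, p.2.1.1) : ZdEdge d) ∈ plaquetteEdges q)
    (hr : ((p.1 + Pi.single p.2.1.2 1, p.2.1.1) : ZdEdge d) ∈ plaquetteEdges r) : Disjoint (plaquetteEdges q) (plaquetteEdges r) := by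
  rw [disjoint_left]
  intro ℓ hℓq hℓr
  have h1 := hiLevel_le_of_mem_base hqp hq hℓq
  have h2 := le_fst_of_mem_shift hrp hr hℓr
  have h3 := fst_le_hiLevel p.2.1.2 ℓ
  omega

/-! ## §3 ★ No closed complex with five plaquettes -/

/-- The parallel pair of `i`-links of a plaquette: `(x, i)` and `(x + e_j, i)` both belong to `p = (x; i, j)` and are distinct. [folklore] -/
theorem parallel_links_mem (p : ZdPlaquette d) :
    ((p.1, p.2.1.1) : ZdEdge d) ∈ plaquetteEdges p ∧ ((p.1 + Pi.single p.2.1.2 1, p.2.1.1) : ZdEdge d) ∈ plaquetteEdges p ∧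
      ((p.1, p.2.1.1) : ZdEdge d) ≠ (p.1 + Pi.single p.2.1.2 1, p.2.1.1) := by
  refine ⟨?_, ?_, ?_⟩
  · simp [plaquetteEdges]
  · simp [plaquetteEdges]
  · intro h
    have := congrFun (Prod.mk.inj h).1 p.2.1.2
    rw [add_single_apply_self] at this; omega

/-- ★ **No closed complex with fewer than six plaquettes**: `closedCount 4 n = 0` for `n ≤ 5`. [folklore] -/
theorem closedCount_four_eq_zero_of_le_five {n : ℕ} (hn : n ≤ 5) : closedCount 4 n = 0 := by
  classical
  unfold closedCount
  haveI : IsEmpty {X : Finset (ZdPlaquette 4) // X.card = n ∧ rootLink 4 ∈ links X ∧ IsLinkConnected X ∧ IsClosedComplex X} :=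
    ⟨fun ⟨X, hcard, hroot, _, hcl⟩ => by
      have hdeg : ∀ l ∈ links X, 2 ≤ (atLink X l).card := fun l hl => hcl l hl
      -- a member `p` and its two neighbours `q`, `r` across the parallel `i`-links
      obtain ⟨p, hpX, -⟩ := mem_biUnion.1 hroot
      obtain ⟨h1p, h2p, hne12⟩ := parallel_links_mem p
      have second : ∀ g ∈ plaquetteEdges p, ∃ q ∈ X, q ≠ p ∧ g ∈ plaquetteEdges q := fun g hg => by
        obtain ⟨q, hq, hqp⟩ := Finset.exists_mem_ne (lt_of_lt_of_le one_lt_two (hdeg g (mem_biUnion.2 ⟨p, hpX, hg⟩))) p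
        exact ⟨q, (mem_filter.1 hq).1, hqp, (mem_filter.1 hq).2⟩
      obtain ⟨q, hqX, hqp, hq⟩ := second _ h1p
      obtain ⟨r, hrX, hrp, hr⟩ := second _ h2p
      have hdisj := disjoint_plaquetteEdges_of_parallel hqp hrp hq hr
      have hqr : q ≠ r := by
        rintro rfl
        exact disjoint_left.1 hdisj hq hq
      -- the pair `{q, r}` is a 2-subset of `X` through NO common link
      have hpair : ({q, r} : Finset (ZdPlaquette 4)) ∈ X.powersetCard 2 := by
        rw [mem_powersetCard]
        refine ⟨?_, card_pair hqr⟩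
        intro s hs
        rcases mem_insert.1 hs with rfl | hs
        · exact hqX
        · rw [mem_singleton.1 hs]; exact hrX
      have hnot : ∀ l ∈ links X, ({q, r} : Finset (ZdPlaquette 4)) ∉ (atLink X l).powersetCard 2 := fun l _ hmem => by
        rw [mem_powersetCard] at hmem
        have hql := (mem_filter.1 (hmem.1 (mem_insert_self _ _))).2
        have hrl := (mem_filter.1 (hmem.1 (mem_insert_of_mem (mem_singleton_self _)))).2
        exact disjoint_left.1 hdisj hql hrl
      -- double count with the missing pair: `Σ_l C(deg l, 2) ≤ C(n, 2) − 1`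
      have hsum : ∑ l ∈ links X, ((atLink X l).card.choose 2) ≤ X.card.choose 2 - 1 := by
        have hrw : ∀ l ∈ links X, (atLink X l).card.choose 2 = ((atLink X l).powersetCard 2).card := fun l _ => (card_powersetCard 2 _).symm
        rw [sum_congr rfl hrw, ← card_biUnion]
        · have hsub : (links X).biUnion (fun l => (atLink X l).powersetCard 2) ⊆ (X.powersetCard 2).erase {q, r} := by
            intro s hs
            obtain ⟨l, hl, hsl⟩ := mem_biUnion.1 hs
            refine mem_erase.2 ⟨fun h => hnot l hl (h ▸ hsl), powersetCard_mono (filter_subset _ _) hsl⟩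
          refine (card_le_card hsub).trans ?_
          rw [card_erase_of_mem hpair, card_powersetCard]
        · intro l₁ _ l₂ _ hne
          rw [Function.onFun, disjoint_left]
          intro s hs₁ hs₂
          rw [mem_powersetCard] at hs₁ hs₂
          obtain ⟨hs₁, hc⟩ := hs₁
          obtain ⟨hs₂, -⟩ := hs₂
          obtain ⟨a, b, hab, rfl⟩ := card_eq_two.1 hc
          have ha₁ := (mem_filter.1 (hs₁ (mem_insert_self _ _))).2
          have hb₁ := (mem_filter.1 (hs₁ (mem_insert_of_mem (mem_singleton_self _)))).2
          have ha₂ := (mem_filter.1 (hs₂ (mem_insert_self _ _))).2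
          have hb₂ := (mem_filter.1 (hs₂ (mem_insert_of_mem (mem_singleton_self _)))).2
          exact hab (eq_of_mem_plaquetteEdges_of_ne hne ha₁ ha₂ hb₁ hb₂)
      -- `deg ≤ 2·C(deg, 2)` for `deg ≥ 2`, summed: `4n ≤ 2·(C(n,2) − 1)`
      have hle : ∀ l ∈ links X, (atLink X l).card ≤ 2 * ((atLink X l).card.choose 2) := fun l hl => by
        have h2 := hdeg l hl
        rw [Nat.choose_two_right]
        have : 2 * ((atLink X l).card * ((atLink X l).card - 1) / 2) = (atLink X l).card * ((atLink X l).card - 1) :=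
          Nat.two_mul_div_two_of_even (Nat.even_mul_pred_self _)
        rw [this]
        calc (atLink X l).card = (atLink X l).card * 1 := (mul_one _).symm
          _ ≤ (atLink X l).card * ((atLink X l).card - 1) := Nat.mul_le_mul_left _ (by omega)
      have h1 : 4 * X.card ≤ 2 * (X.card.choose 2 - 1) :=
        calc 4 * X.card = ∑ l ∈ links X, (atLink X l).card := (sum_card_atLink_eq X).symm
          _ ≤ ∑ l ∈ links X, 2 * ((atLink X l).card.choose 2) := sum_le_sum hle
          _ = 2 * ∑ l ∈ links X, ((atLink X l).card.choose 2) := by rw [mul_sum]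
          _ ≤ 2 * (X.card.choose 2 - 1) := Nat.mul_le_mul_left 2 hsum
      rw [hcard, Nat.choose_two_right] at h1
      have hn1 : 1 ≤ n := by rw [← hcard]; exact card_pos.2 ⟨p, hpX⟩
      interval_cases n <;> omega⟩
  exact Nat.card_of_isEmpty

end Summit.QuantumFields.YangMills.Theorems.Instrument.PlaquetteParallelLinks

end
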